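import Summits.AtomisticToContinuum.BoseEinsteinCondensation.Theses.BECModePrice
import Summits.AtomisticToContinuum.BoseEinsteinCondensation.Theorems.BECLaplacianL1ModeCountingL1
import HarnessLib

/-!
# Route BECModePrice, support item `SofteningModeCount` (stmt-AtomisticToContinuum-18514)

Closes `Summit.AtomisticToContinuum.BoseEinsteinCondensation.Theses.BECModePrice.SofteningModeCount`
(`[SMS body for v] → [DiluteEnergyBound body for v] → [PeriodicBEC body for v]`, bodies inlined):
a uniform `O(ρ)` single-mode softening price
`E₀^per(N,L) + ½|2πp/L|² n_p(Ψ) ≤ ⟨Ψ,HΨ⟩ + Cρ` (all `p ≠ 0`, all periodic trial states, eventually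
in `N`, `L = (N/ρ)^{1/3}`) together with the crude energy bound `E₀^per ≤ C'ρ^{2/3}N` implies
condensation `⟨Ψ, n₀Ψ⟩ ≥ N/2` of the `δ`-near-minimisers at all small densities. Proof:

* the **chord**: for a `δ`-near-minimiser, `E₀ + ½|k|²n_k ≤ ⟨Ψ,HΨ⟩ + Cρ ≤ E₀ + δ + Cρ` and `E₀ < ∞`,
  so `n_k ≤ 2(Cρ+δ)/|2πk/L|² ≤ (Cρ+δ)L²/(2π²‖k‖_∞²)` — an exponent-2 infrared bound whose constant is
  the price;
* the abstract counting step `LaplacianModeCounting.condensate_ge_half_sq`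
  (`Theorems/BECLaplacianL1ModeCountingL1.lean`, architecture of [KLS1988PRL]) with
  `C_ir = (Cρ+δ)L²/(2π²)`, ultraviolet cut `K = κρ^{1/3}L`, `π²κ² = C'+1`, slack
  `δ ≤ min(ρ, ρ^{2/3}N)`: the tail `‖k‖_∞ > K` carries `≤ (E₀+δ)/(4π²κ²ρ^{2/3}) ≤ N/4` particles and
  the window `26 C_ir K = 13κρ^{1/3}(Cρ+δ)L³/π² ≤ 13κρ^{1/3}(C+1)N/π² ≤ N/4` once
  `ρ^{1/3} ≤ π²/(52κ(C+1))`; Parseval gives `n₀ ≥ N/2`.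

## References

* [KLS1988PRL] T. Kennedy, E. H. Lieb, B. S. Shastry, Phys. Rev. Lett. 61 (1988) 2582 (infrared
  bound ⇒ long-range order by mode counting in `d = 3`).
* [DLS1978] F. J. Dyson, E. H. Lieb, B. Simon, J. Stat. Phys. 18 (1978) 335 (exponent-2 infrared
  bounds and the `d = 3` mode count).
* [LSSY2005] E. H. Lieb, R. Seiringer, J. P. Solovej, J. Yngvason, *The Mathematics of the Bose Gas
  and its Condensation*, Birkhäuser 2005, §1.2 (1.17)–(1.19).
-/

noncomputable section

open MeasureTheory Filter
open scoped ENNReal NNReal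

namespace Summit.AtomisticToContinuum.BoseEinsteinCondensation.Theorems

open Literature.MathematicalPhysics.QuantumManyBody.BoseGas
open Summit.AtomisticToContinuum.BoseEinsteinCondensation.Theses.BECModePrice
open LaplacianModeCounting ModeCounting

/-- **The chord** (variational single-mode infrared bound from a softening price). If on the torus
of side `L > 0` the state `Ψ` satisfies the single-mode softening inequality
`E₀ + ½|2πk/L|² n_k(Ψ) ≤ ⟨Ψ,HΨ⟩ + P` at a momentum `k ≠ 0`, and `Ψ` is a `δ`-near-minimiser
(`⟨Ψ,HΨ⟩ ≤ E₀ + δ`) of a problem with `E₀ < ∞`, then `n_k(Ψ) ≤ (P + δ)L²/(2π²‖k‖_∞²)`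
(`½|k|²n_k ≤ P + δ`, `|2πk/L|² ≥ 4π²‖k‖_∞²/L²`). [cite: LSSY2005, §1.2 (1.17)–(1.19)] -/
theorem cellOccupation_le_of_softening {N : ℕ} {L P δ : ℝ} (hL : 0 < L) (hP : 0 ≤ P) (hδ : 0 ≤ δ)
    (v : ℝ → ℝ≥0∞) (Ψ : PeriodicTrialState N L)
    (hE : periodicGroundStateEnergy v N L ≠ ⊤)
    (hΨ : periodicEnergy v Ψ ≤ periodicGroundStateEnergy v N L + ENNReal.ofReal δ)
    (k : Fin 3 → ℤ) (hk : k ≠ 0)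
    (hSMS : periodicGroundStateEnergy v N L +
      2⁻¹ * fracDispersion 2 L k * cellOccupation N L (planeWaveMode L k) Ψ.ψ ≤
        periodicEnergy v Ψ + ENNReal.ofReal P) :
    cellOccupation N L (planeWaveMode L k) Ψ.ψ ≤
      ENNReal.ofReal ((P + δ) * L ^ 2 / (2 * Real.pi ^ 2) / ‖(fun i => (k i : ℝ))‖ ^ 2) := by
  have hν : 0 < ‖(fun i => (k i : ℝ))‖ := by
    refine norm_pos_iff.2 fun h => hk (funext fun j => ?_)
    have := congrFun h j
    simpa using this
  have hsum : 0 < ∑ j, (k j : ℝ) ^ 2 := lt_of_lt_of_le (by positivity) (norm_sq_le_sum_sq k)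
  -- cancel the finite ground-state energy: `½|k|² n_k ≤ δ + P`
  have h1 : periodicGroundStateEnergy v N L +
      2⁻¹ * fracDispersion 2 L k * cellOccupation N L (planeWaveMode L k) Ψ.ψ ≤
        periodicGroundStateEnergy v N L + ENNReal.ofReal (δ + P) := by
    calc periodicGroundStateEnergy v N L +
          2⁻¹ * fracDispersion 2 L k * cellOccupation N L (planeWaveMode L k) Ψ.ψ
        ≤ periodicEnergy v Ψ + ENNReal.ofReal P := hSMS
      _ ≤ periodicGroundStateEnergy v N L + ENNReal.ofReal δ + ENNReal.ofReal P := by gcongr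
      _ = periodicGroundStateEnergy v N L + ENNReal.ofReal (δ + P) := by
          rw [add_assoc, ← ENNReal.ofReal_add hδ hP]
  have h2 : 2⁻¹ * fracDispersion 2 L k * cellOccupation N L (planeWaveMode L k) Ψ.ψ ≤
      ENNReal.ofReal (δ + P) := (ENNReal.add_le_add_iff_left hE).1 h1
  -- the half symbol `½|2πk/L|² = 2π²|k|²/L²` as a real number
  have hpos : 0 < 2 * Real.pi ^ 2 * (∑ j, (k j : ℝ) ^ 2) / L ^ 2 := by positivity
  have hhalf : 2⁻¹ * fracDispersion 2 L k =
      ENNReal.ofReal (2 * Real.pi ^ 2 * (∑ j, (k j : ℝ) ^ 2) / L ^ 2) := by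
    rw [fracDispersion_two, ← ENNReal.ofReal_ofNat 2, ← ENNReal.ofReal_inv_of_pos two_pos,
      ← ENNReal.ofReal_mul (by norm_num)]
    exact congrArg ENNReal.ofReal (by ring)
  have hne0 : 2⁻¹ * fracDispersion 2 L k ≠ 0 := by
    rw [hhalf]
    exact (ENNReal.ofReal_pos.2 hpos).ne'
  have hnetop : 2⁻¹ * fracDispersion 2 L k ≠ ⊤ := by
    rw [hhalf]
    exact ENNReal.ofReal_ne_top
  calc cellOccupation N L (planeWaveMode L k) Ψ.ψ
      ≤ ENNReal.ofReal (δ + P) / (2⁻¹ * fracDispersion 2 L k) := by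
        rw [ENNReal.le_div_iff_mul_le (Or.inl hne0) (Or.inl hnetop)]
        calc cellOccupation N L (planeWaveMode L k) Ψ.ψ * (2⁻¹ * fracDispersion 2 L k)
            = 2⁻¹ * fracDispersion 2 L k * cellOccupation N L (planeWaveMode L k) Ψ.ψ :=
              mul_comm _ _
          _ ≤ ENNReal.ofReal (δ + P) := h2
    _ = ENNReal.ofReal ((δ + P) / (2 * Real.pi ^ 2 * (∑ j, (k j : ℝ) ^ 2) / L ^ 2)) := by
        rw [hhalf, ENNReal.ofReal_div_of_pos hpos]
    _ = ENNReal.ofReal ((P + δ) * L ^ 2 / (2 * Real.pi ^ 2) / ∑ j, (k j : ℝ) ^ 2) := by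
        congr 1
        field_simp
        ring
    _ ≤ ENNReal.ofReal ((P + δ) * L ^ 2 / (2 * Real.pi ^ 2) / ‖(fun i => (k i : ℝ))‖ ^ 2) := by
        refine ENNReal.ofReal_le_ofReal ?_
        exact div_le_div_of_nonneg_left (by positivity) (by positivity) (norm_sq_le_sum_sq k)

/-- **Torus BEC from a uniform single-mode softening price by mode counting** (route BECModePrice,
item `SofteningModeCount`, stmt-AtomisticToContinuum-18514). For every repulsive finite-range `v`:
if `E₀^per + ½|2πp/L|² n_p(Ψ) ≤ ⟨Ψ,HΨ⟩ + Cρ` for all `p ≠ 0` and all periodic trial states on the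
torus of side `L_N = (N/ρ)^{1/3}` (small `ρ`, eventually in `N`), and `E₀^per ≤ C'ρ^{2/3}N`, then
the `δ`-near-minimisers condense, `⟨Ψ, n₀Ψ⟩ ≥ N/2`, for all small `ρ`. Proof: with `s = ρ^{1/3}`,
`κ = √(C'+1)/π`, slack `δ = min(ρ, s²N)`: the chord `n_k ≤ (Cρ+δ)L²/(2π²‖k‖_∞²)`
(`cellOccupation_le_of_softening`) feeds `condensate_ge_half_sq` with `K = κsL`: the tail carries
`≤ (C'+1)s²N/(4π²κ²s²) = N/4`, the window `26·(Cρ+δ)L²/(2π²)·κsL ≤ 13κs(C+1)N/π² ≤ N/4` for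
`s ≤ π²/(52κ(C+1))`. [cite: LSSY2005, §1.2 (1.17)–(1.19)] -/
theorem softeningModeCount_proof : SofteningModeCount := by
  intro v _hv hX hE
  obtain ⟨C, hC, ρX, hρX, hXv⟩ := hX
  obtain ⟨C', hC', ρE, hρE, hEv⟩ := hE
  -- constants
  set κ : ℝ := Real.sqrt (C' + 1) / Real.pi with hκ
  have hκ0 : 0 < κ := by positivity
  have hκ2 : Real.pi ^ 2 * κ ^ 2 = C' + 1 := by
    rw [hκ, div_pow, Real.sq_sqrt (by positivity)]
    field_simp
  -- the density window: `ρ^{1/3} ≤ s₀ = π²/(52κ(C+1))`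
  set s₀ : ℝ := Real.pi ^ 2 / (52 * κ * (C + 1)) with hs₀
  have hs₀0 : 0 < s₀ := by positivity
  refine ⟨min (min ρX ρE) (s₀ ^ 3), lt_min (lt_min hρX hρE) (by positivity), fun ρ hρ hρ₀ => ?_⟩
  have hρX' : ρ < ρX := lt_of_lt_of_le hρ₀ ((min_le_left _ _).trans (min_le_left _ _))
  have hρE' : ρ < ρE := lt_of_lt_of_le hρ₀ ((min_le_left _ _).trans (min_le_right _ _))
  have hρW : ρ < s₀ ^ 3 := lt_of_lt_of_le hρ₀ (min_le_right _ _)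
  -- `s = ρ^{1/3}`
  set s : ℝ := ρ ^ ((1 : ℝ) / 3) with hs
  have hs0 : 0 < s := Real.rpow_pos_of_pos hρ _
  have hs2 : ρ ^ ((2 : ℝ) / 3) = s ^ 2 := by
    rw [hs, show ((2 : ℝ) / 3) = (1 : ℝ) / 3 * 2 by norm_num, Real.rpow_mul hρ.le, Real.rpow_two]
  have hs3 : s ^ 3 = ρ := by
    rw [hs, ← Real.rpow_natCast, ← Real.rpow_mul hρ.le]
    norm_num
  have hsW : s ≤ s₀ := by
    have h1 : s ≤ (s₀ ^ 3) ^ ((1 : ℝ) / 3) := Real.rpow_le_rpow hρ.le hρW.le (by norm_num)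
    rwa [← Real.rpow_natCast, ← Real.rpow_mul hs₀0.le, show ((3 : ℕ) : ℝ) * ((1 : ℝ) / 3) = 1 by
      norm_num, Real.rpow_one] at h1
  -- the answer: `c = 1/2`, eventually in `N`
  refine ⟨1 / 2, by norm_num, ?_⟩
  filter_upwards [hXv ρ hρ hρX', hEv ρ hρ hρE', eventually_ge_atTop 1] with N hXN hEN hN1
  have hNr : (0 : ℝ) < N := Nat.cast_pos.2 hN1
  set L : ℝ := sideLength ρ N with hLdef
  have hL : 0 < L := Real.rpow_pos_of_pos (div_pos hNr hρ) _
  have hL3 : L ^ 3 = N / ρ := by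
    rw [hLdef, sideLength, ← Real.rpow_natCast, ← Real.rpow_mul (div_pos hNr hρ).le]
    norm_num
  -- the slack `δ_N = min(ρ, s²N)`
  set δr : ℝ := min ρ (s ^ 2 * N) with hδr
  have hδr0 : 0 < δr := lt_min hρ (by positivity)
  refine ⟨ENNReal.ofReal δr, ENNReal.ofReal_pos.2 hδr0, ?_⟩
  intro Ψ hΨ
  have hE0top : periodicGroundStateEnergy v N L ≠ ⊤ := ne_top_of_le_ne_top ENNReal.ofReal_ne_top hEN
  have hΨE : periodicEnergy v Ψ ≤ ENNReal.ofReal ((C' + 1) * s ^ 2 * N) := by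
    calc periodicEnergy v Ψ ≤ periodicGroundStateEnergy v N L + ENNReal.ofReal (s ^ 2 * N) :=
          hΨ.trans (add_le_add le_rfl (ENNReal.ofReal_le_ofReal (min_le_right _ _)))
      _ ≤ ENNReal.ofReal (C' * ρ ^ ((2 : ℝ) / 3) * N) + ENNReal.ofReal (s ^ 2 * N) :=
          add_le_add hEN le_rfl
      _ = ENNReal.ofReal ((C' + 1) * s ^ 2 * N) := by
          rw [hs2, ← ENNReal.ofReal_add (by positivity) (by positivity)]
          exact congrArg ENNReal.ofReal (by ring)
  -- the counting step with `K = κ s L`, `C_ir = (Cρ+δ)L²/(2π²)`, `D = 4π²κ²s²`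
  set D : ℝ≥0∞ := ENNReal.ofReal (4 * Real.pi ^ 2 * κ ^ 2 * s ^ 2) with hD
  have hDpos : 0 < 4 * Real.pi ^ 2 * κ ^ 2 * s ^ 2 := by positivity
  have hD0 : D ≠ 0 := (ENNReal.ofReal_pos.2 hDpos).ne'
  refine condensate_ge_half_sq hL (K := κ * s * L)
    (Cir := (C * ρ + δr) * L ^ 2 / (2 * Real.pi ^ 2)) (by positivity) (by positivity) v Ψ hD0
    ENNReal.ofReal_ne_top ?_ ?_ ?_ ?_
  · -- (IR) the chord from the softening price at `(k, Ψ)` (inlined plane wave / symbol are `rfl`)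
    intro k hk0 _hkK
    have hSMS : periodicGroundStateEnergy v N L +
        2⁻¹ * fracDispersion 2 L k * cellOccupation N L (planeWaveMode L k) Ψ.ψ ≤
          periodicEnergy v Ψ + ENNReal.ofReal (C * ρ) := hXN k hk0 Ψ
    exact cellOccupation_le_of_softening hL (by positivity) hδr0.le v Ψ hE0top hΨ k hk0 hSMS
  · -- (UV) `4π²κ²s² ≤ |2πk/L|²` off the window (`‖k‖_∞² ≤ |k|₂²`)
    intro k hk
    rw [hD, fracDispersion_two]
    refine ENNReal.ofReal_le_ofReal ?_
    have h1 : (κ * s * L) ^ 2 < ∑ j, (k j : ℝ) ^ 2 := by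
      calc (κ * s * L) ^ 2 < ‖(fun i => (k i : ℝ))‖ ^ 2 := by gcongr
        _ ≤ ∑ j, (k j : ℝ) ^ 2 := norm_sq_le_sum_sq k
    rw [mul_pow, mul_pow] at h1
    rw [le_div_iff₀ (by positivity)]
    calc 4 * Real.pi ^ 2 * κ ^ 2 * s ^ 2 * L ^ 2 = 4 * Real.pi ^ 2 * (κ ^ 2 * s ^ 2 * L ^ 2) := by
          ring
      _ ≤ 4 * Real.pi ^ 2 * ∑ j, (k j : ℝ) ^ 2 := by gcongr
  · -- (T) `(E₀ + δ)/(4π²κ²s²) ≤ (C'+1)s²N/(4(C'+1)s²) = N/4`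
    calc D⁻¹ * periodicEnergy v Ψ ≤ D⁻¹ * ENNReal.ofReal ((C' + 1) * s ^ 2 * N) := by gcongr
      _ = ENNReal.ofReal ((C' + 1) * s ^ 2 * N / (4 * Real.pi ^ 2 * κ ^ 2 * s ^ 2)) := by
          rw [← ENNReal.div_eq_inv_mul, hD, ← ENNReal.ofReal_div_of_pos hDpos]
      _ = ENNReal.ofReal (N / 4) := by
          congr 1
          rw [show 4 * Real.pi ^ 2 * κ ^ 2 * s ^ 2 = 4 * (Real.pi ^ 2 * κ ^ 2) * s ^ 2 by ring, hκ2]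
          field_simp
  · -- (window) `(Cρ+δ)L²/(2π²) · 26κsL = 13κs(Cρ+δ)N/(ρπ²) ≤ 13κs(C+1)N/π² ≤ N/4`
    have hδρ : C * ρ + δr ≤ (C + 1) * ρ := by
      have := min_le_left ρ (s ^ 2 * N)
      linarith
    have hkey : 13 * κ * s * (C + 1) ≤ Real.pi ^ 2 / 4 := by
      have h1 : s * (52 * κ * (C + 1)) ≤ Real.pi ^ 2 := by
        rw [← le_div_iff₀ (by positivity)]
        exact hsW
      linarith
    calc (C * ρ + δr) * L ^ 2 / (2 * Real.pi ^ 2) * (26 * (κ * s * L))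
        = 13 * κ * s * (C * ρ + δr) * L ^ 3 / Real.pi ^ 2 := by ring
      _ = 13 * κ * s * (C * ρ + δr) * (N / ρ) / Real.pi ^ 2 := by rw [hL3]
      _ ≤ 13 * κ * s * ((C + 1) * ρ) * (N / ρ) / Real.pi ^ 2 := by gcongr
      _ = 13 * κ * s * (C + 1) * N / Real.pi ^ 2 := by
          field_simp
      _ ≤ Real.pi ^ 2 / 4 * N / Real.pi ^ 2 := by gcongr
      _ = N / 4 := by
          field_simp

end Summit.AtomisticToContinuum.BoseEinsteinCondensation.Theorems

end
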